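import Literature.NumberTheory.EllipticCurves.BinaryQuarticRealOrbitsProofs
import Mathlib.NumberTheory.Modular
import HarnessLib

/-!
# Reduction theory for integral binary quartic forms: Gauss's fundamental domain on `SL₂(ℝ)`,
# the Iwasawa coordinates `n(u) a(t) k`, and the finiteness of the class counts `N(S; X)`

`Proofs` companion of `BinaryQuarticForms.lean` (theorems only: no definitions, no named facts),
continuing `BinaryQuarticRealOrbitsProofs.lean`, on the archimedean reduction theory of
Bhargava–Shankar's Thm 2.1 (`Literature.NumberTheory.EllipticCurves.bhargavaShankar_classCount`):
M. Bhargava, A. Shankar, *Binary quartic forms having bounded invariants, and the boundedness of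
the average rank of elliptic curves*, Ann. of Math. (2) 181 (2015) 191–242, §2.1 (held arXiv text
`arXiv:1006.1002v2`, p. 9): "Let `𝓕` denote Gauss's usual fundamental domain for
`GL₂(ℤ)\GL₂(ℝ)` in `GL₂(ℝ)`. Then `𝓕` may be expressed in the form
`𝓕 = {nαkλ : n(u) ∈ N'(t), α(t) ∈ A', k ∈ K, λ ∈ Λ}`, where `N'(α) = {(1 0; u 1) : u ∈ ν(α)}`,
`A' = {diag(t⁻¹, t) : t ≥ √3/2}`, … `ν(α)` is a union of one or two subintervals of `[−½, ½]`",
and "the cusp contains only reducible points" (§2.2–2.3: an integral form in the cuspidal region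
`t ≫ λ` has `a = 0`).

## Contents (all proved)

1. `iwasawa_eq`: every real `m` with `det m = 1` is `n(u)·a(t)·k` with `n(u) = (1 0; u 1)`,
   `a(t) = diag(t⁻¹, t)`, `k = (α β; −β α)`, `α² + β² = 1`, explicitly `t⁻² = m₀₀² + m₀₁²`,
   `u = (m₀₀m₁₀ + m₀₁m₁₁) t²`, `(α, β) = t (m₀₀, m₀₁)`.
2. `exists_sl2z_mul_mem_gaussDomain`: **Gauss reduction** — for every real `s` with `det s = 1`
   there is `δ ∈ SL₂(ℤ)` such that `m = δ s` satisfies `2|m₀₀m₁₀ + m₀₁m₁₁| ≤ m₀₀² + m₀₁²` and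
   `(m₀₀² + m₀₁²)² ≤ (m₀₀m₁₀ + m₀₁m₁₁)² + 1`, i.e. `|u| ≤ ½` and `t⁴ ≥ ¾` in the coordinates of 1
   (`gaussDomain_bounds`); transported from Mathlib's `ModularGroup.exists_smul_mem_fd` through
   the point `m ↦ (m^⊤)⁻¹ · i = −u + t² i` of `ℍ` (`moebius_special_point`).
3. `exists_eq_subst_bounded`: every real form with `Δ ≠ 0`, or definite, is `γ · g` with
   `det γ = ±1` and all `|g_i| ≤ 1 + |I| + |J|` (from `BinaryQuarticRealOrbitsProofs`: the
   boundedness of the fundamental sets `L_V^{(i)}`).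
4. `coeff_bound_subst`: coefficients grow at most by `30 M⁴` under a substitution with entries
   bounded by `M`.
5. `exists_equiv_coeff_le`: **the cusp** — an irreducible integral `f` with `H(f) < X` (and
   `Δ ≠ 0` or definite) is `GL₂(ℤ)`-equivalent to `n(u)a(t)k · g` with `|u| ≤ ½`, `¾ ≤ t⁴ ≤ 30B`,
   `B = 3 + 5X` (the leading coefficient `t⁻⁴(k·g)_a` is a nonzero integer, as `f` has no rational
   zero), hence to a form with all coefficients `≤ C(X)`; so (`finite_gl2zOrbits`,
   `finite_orbits_realTypes`) **the orbit sets counted by `N(V_ℤ^{(i)}; X)` are finite**,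
   unconditionally (in `BhargavaShankarClassCountProofs` this was derived from Thm 2.1 itself).

## References

* M. Bhargava, A. Shankar, Ann. of Math. (2) 181 (2015) 191–242 = arXiv:1006.1002, §2.1 (Gauss's
  fundamental domain `𝓕 = N'A'KΛ`), §2.2–2.3 (the cusp). [cite: BhargavaShankarAnnals2015, §2.1 (the fundamental domain F; arXiv:1006.1002v2 numbering)]
-/

noncomputable section

open scoped Classical MatrixGroups
open Polynomial

namespace Literature.NumberTheory.EllipticCurves

namespace BinaryQuartic

/-! ## §1 Iwasawa coordinates on `SL₂(ℝ)` -/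

section Iwasawa

/-- The first row of a real matrix of determinant `1` is nonzero: `m₀₀² + m₀₁² > 0`. [folklore] -/
theorem rowNormSq_pos {m : Matrix (Fin 2) (Fin 2) ℝ} (hm : m.det = 1) :
    0 < m 0 0 ^ 2 + m 0 1 ^ 2 := by
  by_contra hle
  push Not at hle
  have h0 : m 0 0 = 0 := by nlinarith [sq_nonneg (m 0 0), sq_nonneg (m 0 1)]
  have h1 : m 0 1 = 0 := by nlinarith [sq_nonneg (m 0 0), sq_nonneg (m 0 1)]
  rw [Matrix.det_fin_two, h0, h1] at hm
  norm_num at hm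

/-- **Iwasawa coordinates.** A real matrix `m` of determinant `1` factors as
`m = n(u) · a(t) · k` with `n(u) = (1 0; u 1)`, `a(t) = diag(t⁻¹, t)` and `k = (α β; −β α)` a
rotation (`α² + β² = 1`), where `t = (m₀₀² + m₀₁²)^{-1/2}`, `u = (m₀₀m₁₀ + m₀₁m₁₁) t²` and
`(α, β) = t·(m₀₀, m₀₁)` (Bhargava–Shankar 2015, §2.1: `GL₂(ℝ) ∋ nαkλ`; here for `SL₂(ℝ)`, `λ = 1`).
[cite: BhargavaShankarAnnals2015, §2.1 (F = N'A'KΛ; arXiv:1006.1002v2 numbering)] -/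
theorem iwasawa_eq {m : Matrix (Fin 2) (Fin 2) ℝ} (hm : m.det = 1) :
    ∃ t u α β : ℝ, 0 < t ∧ t ^ 2 * (m 0 0 ^ 2 + m 0 1 ^ 2) = 1 ∧
      u * (m 0 0 ^ 2 + m 0 1 ^ 2) = m 0 0 * m 1 0 + m 0 1 * m 1 1 ∧ α ^ 2 + β ^ 2 = 1 ∧
      α = t * m 0 0 ∧ β = t * m 0 1 ∧
      m = !![1, 0; u, 1] * !![t⁻¹, 0; 0, t] * !![α, β; -β, α] := by
  set N : ℝ := m 0 0 ^ 2 + m 0 1 ^ 2 with hNdef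
  set e : ℝ := m 0 0 * m 1 0 + m 0 1 * m 1 1 with hedef
  have hN : 0 < N := rowNormSq_pos hm
  have hsq : Real.sqrt N ^ 2 = N := Real.sq_sqrt hN.le
  have hs0 : 0 < Real.sqrt N := Real.sqrt_pos.mpr hN
  set t : ℝ := (Real.sqrt N)⁻¹ with htdef
  have ht : 0 < t := inv_pos.mpr hs0
  have ht2 : t ^ 2 = N⁻¹ := by rw [htdef, inv_pow, hsq]
  have htN : t ^ 2 * N = 1 := by rw [ht2, inv_mul_cancel₀ hN.ne']
  have hdet : m 0 0 * m 1 1 - m 0 1 * m 1 0 = 1 := by rw [← Matrix.det_fin_two]; exact hm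
  set u : ℝ := e / N with hudef
  have huN : u * N = e := by rw [hudef, div_mul_cancel₀ _ hN.ne']
  -- the second row in the new coordinates
  have key10 : u * m 0 0 - t ^ 2 * m 0 1 = m 1 0 := by
    have h1 : (u * m 0 0 - t ^ 2 * m 0 1) * N = m 1 0 * N := by
      have : (u * m 0 0 - t ^ 2 * m 0 1) * N = u * N * m 0 0 - t ^ 2 * N * m 0 1 := by ring
      rw [this, huN, htN, hedef, hNdef]
      linear_combination (m 0 1) * hdet
    exact mul_right_cancel₀ hN.ne' h1
  have key11 : u * m 0 1 + t ^ 2 * m 0 0 = m 1 1 := by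
    have h1 : (u * m 0 1 + t ^ 2 * m 0 0) * N = m 1 1 * N := by
      have : (u * m 0 1 + t ^ 2 * m 0 0) * N = u * N * m 0 1 + t ^ 2 * N * m 0 0 := by ring
      rw [this, huN, htN, hedef, hNdef]
      linear_combination (-(m 0 0)) * hdet
    exact mul_right_cancel₀ hN.ne' h1
  refine ⟨t, u, t * m 0 0, t * m 0 1, ht, htN, huN, ?_, rfl, rfl, ?_⟩
  · have : (t * m 0 0) ^ 2 + (t * m 0 1) ^ 2 = t ^ 2 * N := by rw [hNdef]; ring
    rw [this, htN]
  · have ht0 : t ≠ 0 := ht.ne'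
    rw [Matrix.mul_fin_two, Matrix.mul_fin_two]
    ext i j
    fin_cases i <;> fin_cases j
    · simp only [Matrix.of_apply, Matrix.cons_val', Matrix.cons_val_zero, Matrix.cons_val_fin_one,
        Fin.zero_eta, Fin.isValue]
      field_simp
      ring
    · simp only [Matrix.of_apply, Matrix.cons_val', Matrix.cons_val_zero, Matrix.cons_val_one,
        Matrix.cons_val_fin_one, Fin.zero_eta, Fin.mk_one, Fin.isValue]
      field_simp
      ring
    · simp only [Matrix.of_apply, Matrix.cons_val', Matrix.cons_val_zero, Matrix.cons_val_one,
        Matrix.cons_val_fin_one, Fin.zero_eta, Fin.mk_one, Fin.isValue]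
      rw [← key10]
      field_simp
      ring
    · simp only [Matrix.of_apply, Matrix.cons_val', Matrix.cons_val_one,
        Matrix.cons_val_fin_one, Fin.mk_one, Fin.isValue]
      rw [← key11]
      field_simp
      ring

end Iwasawa

/-! ## §2 Gauss reduction: transport of the modular fundamental domain to `SL₂(ℝ)` -/

section Gauss

/-- Real and imaginary part of the Möbius image `(p z₀ + q)/(r z₀ + s)` of the point
`z₀ = (−e + i)/N`. [folklore] -/
theorem moebius_special_point (p q r s e N : ℝ) (hN : N ≠ 0) :
    (((p : ℂ) * (⟨-e / N, 1 / N⟩ : ℂ) + q) / ((r : ℂ) * (⟨-e / N, 1 / N⟩ : ℂ) + s)).re =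
        ((-p * e + q * N) * (-r * e + s * N) + p * r) / ((-r * e + s * N) ^ 2 + r ^ 2) ∧
      (((p : ℂ) * (⟨-e / N, 1 / N⟩ : ℂ) + q) / ((r : ℂ) * (⟨-e / N, 1 / N⟩ : ℂ) + s)).im =
        N * (p * s - q * r) / ((-r * e + s * N) ^ 2 + r ^ 2) := by
  have hnum : (p : ℂ) * (⟨-e / N, 1 / N⟩ : ℂ) + q = ⟨(-p * e + q * N) / N, p / N⟩ := by
    apply Complex.ext
    · simp only [Complex.add_re, Complex.mul_re, Complex.ofReal_re, Complex.ofReal_im, zero_mul,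
        sub_zero]
      field_simp
    · simp only [Complex.add_im, Complex.mul_im, Complex.ofReal_re, Complex.ofReal_im, zero_mul,
        add_zero]
      field_simp
  have hden : (r : ℂ) * (⟨-e / N, 1 / N⟩ : ℂ) + s = ⟨(-r * e + s * N) / N, r / N⟩ := by
    apply Complex.ext
    · simp only [Complex.add_re, Complex.mul_re, Complex.ofReal_re, Complex.ofReal_im, zero_mul,
        sub_zero]
      field_simp
    · simp only [Complex.add_im, Complex.mul_im, Complex.ofReal_re, Complex.ofReal_im, zero_mul,
        add_zero]
      field_simp
  have hnsq : Complex.normSq (⟨(-r * e + s * N) / N, r / N⟩ : ℂ) =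
      ((-r * e + s * N) ^ 2 + r ^ 2) / N ^ 2 := by
    rw [Complex.normSq_mk]; field_simp
  rw [hnum, hden]
  constructor
  · rw [Complex.div_re, hnsq]
    simp only
    field_simp
  · rw [Complex.div_im, hnsq]
    simp only
    field_simp
    ring

/-- Lagrange's identity for a matrix of determinant `1`:
`(a² + b²)(c² + d²) = (ac + bd)² + 1`. [folklore] -/
theorem lagrange_identity_of_det {a b c d : ℝ} (h : a * d - b * c = 1) :
    (a ^ 2 + b ^ 2) * (c ^ 2 + d ^ 2) = (a * c + b * d) ^ 2 + 1 := by
  linear_combination (a * d - b * c + 1) * h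

/-- **Gauss reduction on `SL₂(ℝ)`** (the fundamental domain `𝓕` of Bhargava–Shankar 2015, §2.1,
restricted to `SL₂`): for every real `s` with `det s = 1` there is `δ ∈ SL₂(ℤ)` such that the rows
`(a, b)`, `(c, d)` of `m = δ s` satisfy `2|ac + bd| ≤ a² + b²` and `(a² + b²)² ≤ (ac + bd)² + 1`;
in the Iwasawa coordinates `m = n(u) a(t) k` of `iwasawa_eq` (`t⁻² = a² + b²`,
`u = (ac + bd)t²`) this says `|u| ≤ ½` and `t⁴ ≥ ¾` (`gaussDomain_bounds`). Obtained from
Mathlib's `ModularGroup.exists_smul_mem_fd` applied to the point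
`z₀ = (s^⊤)⁻¹ · i = (−(ac+bd) + i)/(a² + b²)` of `ℍ`, with `δ = (g^⊤)⁻¹` for the reducing
`g ∈ SL₂(ℤ)`, using `((δs)^⊤)⁻¹ · i = g · z₀` (a direct computation).
[cite: BhargavaShankarAnnals2015, §2.1 (Gauss's fundamental domain F = N'A'KΛ; arXiv:1006.1002v2 numbering)] -/
theorem exists_sl2z_mul_mem_gaussDomain (s : Matrix (Fin 2) (Fin 2) ℝ) (hs : s.det = 1) :
    ∃ δ : Matrix (Fin 2) (Fin 2) ℤ, δ.det = 1 ∧ ∀ m : Matrix (Fin 2) (Fin 2) ℝ,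
      m = δ.map (Int.castRingHom ℝ) * s →
        2 * |m 0 0 * m 1 0 + m 0 1 * m 1 1| ≤ m 0 0 ^ 2 + m 0 1 ^ 2 ∧
          (m 0 0 ^ 2 + m 0 1 ^ 2) ^ 2 ≤ (m 0 0 * m 1 0 + m 0 1 * m 1 1) ^ 2 + 1 := by
  -- the entries of `s`
  set a : ℝ := s 0 0 with hadef
  set b : ℝ := s 0 1 with hbdef
  set c : ℝ := s 1 0 with hcdef
  set d : ℝ := s 1 1 with hddef
  have hdet : a * d - b * c = 1 := by rw [← Matrix.det_fin_two]; exact hs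
  have hN : 0 < a ^ 2 + b ^ 2 := rowNormSq_pos hs
  have hLag : (a ^ 2 + b ^ 2) * (c ^ 2 + d ^ 2) = (a * c + b * d) ^ 2 + 1 :=
    lagrange_identity_of_det hdet
  -- the point `z₀ = (s^⊤)⁻¹ · i` of `ℍ`
  set z₀c : ℂ := ⟨-(a * c + b * d) / (a ^ 2 + b ^ 2), 1 / (a ^ 2 + b ^ 2)⟩ with hz₀c
  have hz₀ : 0 < z₀c.im := by rw [hz₀c]; positivity
  set z₀ : UpperHalfPlane := ⟨z₀c, hz₀⟩ with hz₀def
  obtain ⟨g, hg⟩ := ModularGroup.exists_smul_mem_fd z₀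
  -- the entries of `g` and `δ = (g^⊤)⁻¹`
  set p : ℤ := (g : Matrix (Fin 2) (Fin 2) ℤ) 0 0 with hpdef
  set q : ℤ := (g : Matrix (Fin 2) (Fin 2) ℤ) 0 1 with hqdef
  set r : ℤ := (g : Matrix (Fin 2) (Fin 2) ℤ) 1 0 with hrdef
  set s' : ℤ := (g : Matrix (Fin 2) (Fin 2) ℤ) 1 1 with hsdef
  have hgdet : p * s' - q * r = 1 := by
    have := g.det_coe; rwa [Matrix.det_fin_two] at this
  have hgdetR : (p : ℝ) * s' - q * r = 1 := by exact_mod_cast hgdet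
  refine ⟨!![s', -r; -q, p], by rw [Matrix.det_fin_two_of]; linear_combination hgdet, ?_⟩
  intro m hm
  -- the entries of `m = δ s`
  have hm00 : m 0 0 = s' * a - r * c := by
    rw [hm]; simp [Matrix.mul_apply, Fin.sum_univ_two]; ring
  have hm01 : m 0 1 = s' * b - r * d := by
    rw [hm]; simp [Matrix.mul_apply, Fin.sum_univ_two]; ring
  have hm10 : m 1 0 = -q * a + p * c := by
    rw [hm]; simp [Matrix.mul_apply, Fin.sum_univ_two]; ring
  have hm11 : m 1 1 = -q * b + p * d := by
    rw [hm]; simp [Matrix.mul_apply, Fin.sum_univ_two]; ring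
  -- `N' = |first row of m|² > 0`
  have hN' : 0 < m 0 0 ^ 2 + m 0 1 ^ 2 := by
    refine rowNormSq_pos (m := m) ?_
    rw [Matrix.det_fin_two, hm00, hm01, hm10, hm11]
    linear_combination ((p : ℝ) * s' - q * r) * hdet + hgdetR
  -- the two key identities behind `((δ s)^⊤)⁻¹ · i = g · z₀`
  have hI1 : (-(r : ℝ) * (a * c + b * d) + s' * (a ^ 2 + b ^ 2)) ^ 2 + (r : ℝ) ^ 2 =
      (a ^ 2 + b ^ 2) * (m 0 0 ^ 2 + m 0 1 ^ 2) := by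
    rw [hm00, hm01]; linear_combination (-(r : ℝ) ^ 2) * hLag
  have hI2 : (-(p : ℝ) * (a * c + b * d) + q * (a ^ 2 + b ^ 2)) *
        (-(r : ℝ) * (a * c + b * d) + s' * (a ^ 2 + b ^ 2)) + p * r =
      -(a ^ 2 + b ^ 2) * (m 0 0 * m 1 0 + m 0 1 * m 1 1) := by
    rw [hm00, hm01, hm10, hm11]; linear_combination (-(p : ℝ) * r) * hLag
  -- the Möbius image `w = g · z₀`, as a complex number
  have hw : ((g • z₀ : UpperHalfPlane) : ℂ) =
      (((p : ℝ) : ℂ) * z₀c + ((q : ℝ) : ℂ)) / (((r : ℝ) : ℂ) * z₀c + ((s' : ℝ) : ℂ)) := by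
    rw [UpperHalfPlane.coe_specialLinearGroup_apply]
    simp only [eq_intCast, hpdef, hqdef, hrdef, hsdef]
    rfl
  obtain ⟨hre, him⟩ := moebius_special_point (p : ℝ) q r s' (a * c + b * d) (a ^ 2 + b ^ 2)
    hN.ne'
  rw [← hz₀c, ← hw, hI2, hI1] at hre
  rw [← hz₀c, ← hw, hgdetR, mul_one, hI1] at him
  -- simplify: `re w = -e'/N'`, `im w = 1/N'`
  have hre' : ((g • z₀ : UpperHalfPlane) : ℂ).re =
      -(m 0 0 * m 1 0 + m 0 1 * m 1 1) / (m 0 0 ^ 2 + m 0 1 ^ 2) := by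
    rw [hre]; field_simp
  have him' : ((g • z₀ : UpperHalfPlane) : ℂ).im = 1 / (m 0 0 ^ 2 + m 0 1 ^ 2) := by
    rw [him]; field_simp
  -- read off the fundamental domain conditions
  simp only [ModularGroup.fd, Set.mem_setOf_eq] at hg
  obtain ⟨hnorm, habs⟩ := hg
  rw [← UpperHalfPlane.coe_re, hre', abs_div, abs_neg, abs_of_pos hN', div_le_iff₀ hN'] at habs
  rw [Complex.normSq_apply, hre', him'] at hnorm
  constructor
  · linarith
  · have h1 : -(m 0 0 * m 1 0 + m 0 1 * m 1 1) / (m 0 0 ^ 2 + m 0 1 ^ 2) *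
          (-(m 0 0 * m 1 0 + m 0 1 * m 1 1) / (m 0 0 ^ 2 + m 0 1 ^ 2)) +
        1 / (m 0 0 ^ 2 + m 0 1 ^ 2) * (1 / (m 0 0 ^ 2 + m 0 1 ^ 2)) =
        ((m 0 0 * m 1 0 + m 0 1 * m 1 1) ^ 2 + 1) / (m 0 0 ^ 2 + m 0 1 ^ 2) ^ 2 := by
      field_simp
    rw [h1, le_div_iff₀ (by positivity), one_mul] at hnorm
    exact hnorm

/-- In the Iwasawa coordinates of `iwasawa_eq` (`t²(a² + b²) = 1`, `u(a² + b²) = ac + bd`), the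
Gauss conditions `2|ac + bd| ≤ a² + b²`, `(a² + b²)² ≤ (ac + bd)² + 1` say `|u| ≤ ½` and
`t⁴ ≥ ¾` (so `t ≥ √3/2`, the set `A'` of Bhargava–Shankar 2015, §2.1). [cite: BhargavaShankarAnnals2015, §2.1 (N'(t) ⊂ [−½, ½], A' = {t ≥ √3/2}; arXiv:1006.1002v2 numbering)] -/
theorem gaussDomain_bounds {N e t u : ℝ} (hN : 0 < N) (ht : 0 < t) (htN : t ^ 2 * N = 1)
    (huN : u * N = e) (h1 : 2 * |e| ≤ N) (h2 : N ^ 2 ≤ e ^ 2 + 1) :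
    |u| ≤ 1 / 2 ∧ 3 / 4 ≤ t ^ 4 ∧ Real.sqrt 3 / 2 ≤ t := by
  have hu : u = e / N := by rw [← huN, mul_div_cancel_right₀ _ hN.ne']
  have habs : |u| ≤ 1 / 2 := by
    rw [hu, abs_div, abs_of_pos hN, div_le_iff₀ hN]; linarith
  have he2 : e ^ 2 ≤ N ^ 2 / 4 := by
    have : |e| ≤ N / 2 := by linarith
    have h0 : 0 ≤ |e| := abs_nonneg e
    calc e ^ 2 = |e| ^ 2 := (sq_abs e).symm
      _ ≤ (N / 2) ^ 2 := pow_le_pow_left₀ h0 this 2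
      _ = N ^ 2 / 4 := by ring
  have hN2 : N ^ 2 ≤ 4 / 3 := by linarith
  have ht2 : t ^ 2 = N⁻¹ := eq_inv_of_mul_eq_one_left htN
  have ht4 : 3 / 4 ≤ t ^ 4 := by
    have : t ^ 4 = (N ^ 2)⁻¹ := by rw [show t ^ 4 = (t ^ 2) ^ 2 by ring, ht2, inv_pow]
    rw [this, le_inv_comm₀ (by norm_num) (by positivity)]
    norm_num
    linarith
  refine ⟨habs, ht4, ?_⟩
  -- `t ≥ (3/4)^{1/4} ≥ √3/2` since `(√3/2)⁴ = 9/16 ≤ 3/4`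
  have h3 : (Real.sqrt 3 / 2) ^ 4 ≤ t ^ 4 := by
    have : (Real.sqrt 3 / 2) ^ 4 = 9 / 16 := by
      rw [div_pow, show Real.sqrt 3 ^ 4 = (Real.sqrt 3 ^ 2) ^ 2 by ring,
        Real.sq_sqrt (by norm_num : (0 : ℝ) ≤ 3)]
      norm_num
    rw [this]; linarith
  exact le_of_pow_le_pow_left₀ (by norm_num) ht.le h3

end Gauss

/-! ## §3 Bounded representatives of the real orbits -/

section Bounded

/-- `√I ≤ 1 + |I|`. [folklore] -/
theorem sqrt_le_one_add_abs (x : ℝ) : Real.sqrt x ≤ 1 + |x| := by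
  rcases le_or_gt x 0 with hx | hx
  · rw [Real.sqrt_eq_zero'.mpr hx]; positivity
  · rw [abs_of_pos hx, Real.sqrt_le_left (by positivity)]
    nlinarith

/-- **Every real binary quartic form with `Δ ≠ 0`, or definite, is `SL₂^{±}(ℝ)`-equivalent to a
form all of whose coefficients are bounded by `1 + |I| + |J|`**: `f = γ · g` with `det γ = ±1` and
`|g_i| ≤ 1 + |I(f)| + |J(f)|` — `g = q_{I,J}` if `f` has a real zero
(`exists_eq_qForm_subst_of_eval_eq_zero`), `g = ±(x² + y²)(Px² + Qxy + Ry²)` with `P + R < √I` if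
`f` is definite (`exists_subst_eq_smul_circleForm_of_isDefinite`, `circleForm_bounds`). This is
the boundedness of Bhargava–Shankar's fundamental sets: "the coefficients of all the binary quartic
forms in the `L_V^{(i)}` are uniformly bounded" (2015, §2.1), in a form scaled by `H(f)`.
[cite: BhargavaShankarAnnals2015, §2.1 (the L_V^{(i)} lie in a compact set; arXiv:1006.1002v2 numbering)] -/
theorem exists_eq_subst_bounded (f : BinaryQuartic ℝ) (hf : f.disc ≠ 0 ∨ f.IsDefinite) :
    ∃ γ : Matrix (Fin 2) (Fin 2) ℝ, (γ.det = 1 ∨ γ.det = -1) ∧ ∃ g : BinaryQuartic ℝ,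
      f = g.subst γ ∧ |g.a| ≤ 1 + |f.I| + |f.J| ∧ |g.b| ≤ 1 + |f.I| + |f.J| ∧
        |g.c| ≤ 1 + |f.I| + |f.J| ∧ |g.d| ≤ 1 + |f.I| + |f.J| ∧ |g.e| ≤ 1 + |f.I| + |f.J| := by
  by_cases hdef : f.IsDefinite
  · -- definite: the circle form, of determinant-`1` equivalence
    obtain ⟨γ, hγ, ε, P, Q, R, hε, hfγ, hP, hR, hQ⟩ :=
      exists_subst_eq_smul_circleForm_of_isDefinite hdef
    have hγ0 : γ.det ≠ 0 := by rw [hγ]; exact one_ne_zero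
    have hγu : IsUnit γ.det := isUnit_iff_ne_zero.mpr hγ0
    obtain ⟨hPR2, hQabs, hPRsqrt⟩ := circleForm_bounds hP hR hQ
    -- `I` of the circle form is `I(f)`
    have hIeq : (⟨P, Q, P + R, Q, R⟩ : BinaryQuartic ℝ).I = f.I := by
      have h1 : (f.subst γ).I = f.I := by rw [I_subst, hγ, one_pow, one_mul]
      rw [hfγ, I_smul] at h1
      rcases hε with h | h <;> rw [h] at h1 <;> simpa using h1
    have hB : P + R ≤ 1 + |f.I| + |f.J| := by
      have := sqrt_le_one_add_abs f.I
      rw [hIeq] at hPRsqrt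
      linarith [abs_nonneg f.J]
    refine ⟨γ⁻¹, ?_, ε • ⟨P, Q, P + R, Q, R⟩, ?_, ?_, ?_, ?_, ?_, ?_⟩
    · rw [Matrix.det_nonsing_inv, Ring.inverse_eq_inv', hγ, inv_one]; exact Or.inl rfl
    · rw [← hfγ, ← subst_mul, Matrix.nonsing_inv_mul γ hγu, subst_one]
    all_goals rcases hε with h | h <;> simp only [h, smul_a, smul_b, smul_c, smul_d, smul_e,
      one_mul, neg_one_mul, abs_neg]
    · rw [abs_of_pos hP]; linarith
    · rw [abs_of_pos hP]; linarith
    · linarith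
    · linarith
    · rw [abs_of_pos (by linarith : 0 < P + R)]; linarith
    · rw [abs_of_pos (by linarith : 0 < P + R)]; linarith
    · linarith
    · linarith
    · rw [abs_of_pos hR]; linarith
    · rw [abs_of_pos hR]; linarith
  · -- not definite: a real zero, and `Δ ≠ 0`
    have hΔ : f.disc ≠ 0 := hf.resolve_right hdef
    obtain ⟨γ, hγ, hfq⟩ := exists_eq_qForm_subst_of_eval_eq_zero hΔ
      ((not_isDefinite_iff_exists_eval_eq_zero f).mp hdef)
    refine ⟨γ, hγ, ⟨0, 1, 0, -f.I / 3, -f.J / 27⟩, hfq, ?_, ?_, ?_, ?_, ?_⟩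
    · simp only [abs_zero]; positivity
    · simp only [abs_one]; linarith [abs_nonneg f.I, abs_nonneg f.J]
    · simp only [abs_zero]; positivity
    · rw [abs_div, abs_neg, abs_of_pos (by norm_num : (0 : ℝ) < 3)]
      linarith [abs_nonneg f.I, abs_nonneg f.J]
    · rw [abs_div, abs_neg, abs_of_pos (by norm_num : (0 : ℝ) < 27)]
      linarith [abs_nonneg f.I, abs_nonneg f.J]

end Bounded

/-! ## §4 Coefficient growth under a substitution with bounded entries -/

section Growth

/-- `|w x y z| ≤ M⁴` when `|w|, |x|, |y|, |z| ≤ M`. [folklore] -/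
theorem abs_prod_four_le {w x y z M : ℝ} (hw : |w| ≤ M) (hx : |x| ≤ M) (hy : |y| ≤ M)
    (hz : |z| ≤ M) : |w * x * y * z| ≤ M ^ 4 := by
  have hM : 0 ≤ M := (abs_nonneg w).trans hw
  rw [abs_mul, abs_mul, abs_mul, show M ^ 4 = M * M * M * M by ring]
  exact mul_le_mul (mul_le_mul (mul_le_mul hw hx (abs_nonneg _) hM) hy (abs_nonneg _)
    (by positivity)) hz (abs_nonneg _) (by positivity)

/-- One term of a transformed coefficient: `|c · g · (wxyz)| ≤ c · (B M⁴)`. [folklore] -/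
theorem abs_term_le {c g w x y z B M : ℝ} (hc : 0 ≤ c) (hg : |g| ≤ B) (hw : |w| ≤ M)
    (hx : |x| ≤ M) (hy : |y| ≤ M) (hz : |z| ≤ M) :
    |c * g * (w * x * y * z)| ≤ c * (B * M ^ 4) := by
  have hB : 0 ≤ B := (abs_nonneg g).trans hg
  rw [abs_mul, abs_mul, abs_of_nonneg hc, mul_assoc]
  refine mul_le_mul_of_nonneg_left ?_ hc
  exact mul_le_mul hg (abs_prod_four_le hw hx hy hz) (abs_nonneg _) hB

/-- **Coefficient growth under substitution.** If all coefficients of `g` are bounded by `B` and all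
entries of `γ` by `M`, then all coefficients of `γ · g = g((x,y)γ)` are bounded by `30 B M⁴` (the
largest coefficient sum, that of `x²y²`, being `6+3+3+1+4+1+3+3+6 = 30`). Used for each factor of
`n(u) a(t) k`. [folklore] -/
theorem coeff_bound_subst {g : BinaryQuartic ℝ} {γ : Matrix (Fin 2) (Fin 2) ℝ} {B M : ℝ}
    (ha : |g.a| ≤ B) (hb : |g.b| ≤ B) (hc : |g.c| ≤ B) (hd : |g.d| ≤ B) (he : |g.e| ≤ B)
    (hM : ∀ i j, |γ i j| ≤ M) :
    |(g.subst γ).a| ≤ 30 * (B * M ^ 4) ∧ |(g.subst γ).b| ≤ 30 * (B * M ^ 4) ∧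
      |(g.subst γ).c| ≤ 30 * (B * M ^ 4) ∧ |(g.subst γ).d| ≤ 30 * (B * M ^ 4) ∧
      |(g.subst γ).e| ≤ 30 * (B * M ^ 4) := by
  have hB : 0 ≤ B := (abs_nonneg _).trans ha
  have hM0 : 0 ≤ M := (abs_nonneg _).trans (hM 0 0)
  have hK : 0 ≤ B * M ^ 4 := by positivity
  set p := γ 0 0; set q := γ 0 1; set r := γ 1 0; set s := γ 1 1
  have hp := hM 0 0; have hq := hM 0 1; have hr := hM 1 0; have hs := hM 1 1
  -- a term bound, in the shape produced below
  have T : ∀ {c g' w x y z : ℝ}, 0 ≤ c → |g'| ≤ B → |w| ≤ M → |x| ≤ M → |y| ≤ M → |z| ≤ M →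
      |c * g' * (w * x * y * z)| ≤ c * (B * M ^ 4) := fun hc hg hw hx hy hz ↦
    abs_term_le hc hg hw hx hy hz
  refine ⟨?_, ?_, ?_, ?_, ?_⟩
  · have h : (g.subst γ).a = 1 * g.a * (p * p * p * p) + 1 * g.b * (p * p * p * q) +
        1 * g.c * (p * p * q * q) + 1 * g.d * (p * q * q * q) + 1 * g.e * (q * q * q * q) := by
      simp only [subst, p, q]; ring
    rw [h]
    refine ((abs_add_le _ _).trans (add_le_add ((abs_add_le _ _).trans (add_le_add
      ((abs_add_le _ _).trans (add_le_add ((abs_add_le _ _).trans (add_le_add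
      (T zero_le_one ha hp hp hp hp) (T zero_le_one hb hp hp hp hq)))
      (T zero_le_one hc hp hp hq hq))) (T zero_le_one hd hp hq hq hq)))
      (T zero_le_one he hq hq hq hq))).trans ?_
    linarith
  · have h : (g.subst γ).b = 4 * g.a * (p * p * p * r) + 1 * g.b * (p * p * p * s) +
        3 * g.b * (p * p * q * r) + 2 * g.c * (p * p * q * s) + 2 * g.c * (p * q * q * r) +
        3 * g.d * (p * q * q * s) + 1 * g.d * (q * q * q * r) + 4 * g.e * (q * q * q * s) := by
      simp only [subst, p, q, r, s]; ring
    rw [h]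
    refine ((abs_add_le _ _).trans (add_le_add ((abs_add_le _ _).trans (add_le_add
      ((abs_add_le _ _).trans (add_le_add ((abs_add_le _ _).trans (add_le_add
      ((abs_add_le _ _).trans (add_le_add ((abs_add_le _ _).trans (add_le_add
      ((abs_add_le _ _).trans (add_le_add
      (T (by norm_num) ha hp hp hp hr) (T zero_le_one hb hp hp hp hs)))
      (T (by norm_num) hb hp hp hq hr))) (T (by norm_num) hc hp hp hq hs)))
      (T (by norm_num) hc hp hq hq hr))) (T (by norm_num) hd hp hq hq hs)))
      (T zero_le_one hd hq hq hq hr))) (T (by norm_num) he hq hq hq hs))).trans ?_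
    linarith
  · have h : (g.subst γ).c = 6 * g.a * (p * p * r * r) + 3 * g.b * (p * p * r * s) +
        3 * g.b * (p * q * r * r) + 1 * g.c * (p * p * s * s) + 4 * g.c * (p * q * r * s) +
        1 * g.c * (q * q * r * r) + 3 * g.d * (p * q * s * s) + 3 * g.d * (q * q * r * s) +
        6 * g.e * (q * q * s * s) := by
      simp only [subst, p, q, r, s]; ring
    rw [h]
    refine ((abs_add_le _ _).trans (add_le_add ((abs_add_le _ _).trans (add_le_add
      ((abs_add_le _ _).trans (add_le_add ((abs_add_le _ _).trans (add_le_add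
      ((abs_add_le _ _).trans (add_le_add ((abs_add_le _ _).trans (add_le_add
      ((abs_add_le _ _).trans (add_le_add ((abs_add_le _ _).trans (add_le_add
      (T (by norm_num) ha hp hp hr hr) (T (by norm_num) hb hp hp hr hs)))
      (T (by norm_num) hb hp hq hr hr))) (T zero_le_one hc hp hp hs hs)))
      (T (by norm_num) hc hp hq hr hs))) (T zero_le_one hc hq hq hr hr)))
      (T (by norm_num) hd hp hq hs hs))) (T (by norm_num) hd hq hq hr hs)))
      (T (by norm_num) he hq hq hs hs))).trans ?_
    linarith
  · have h : (g.subst γ).d = 4 * g.a * (p * r * r * r) + 3 * g.b * (p * r * r * s) +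
        1 * g.b * (q * r * r * r) + 2 * g.c * (p * r * s * s) + 2 * g.c * (q * r * r * s) +
        1 * g.d * (p * s * s * s) + 3 * g.d * (q * r * s * s) + 4 * g.e * (q * s * s * s) := by
      simp only [subst, p, q, r, s]; ring
    rw [h]
    refine ((abs_add_le _ _).trans (add_le_add ((abs_add_le _ _).trans (add_le_add
      ((abs_add_le _ _).trans (add_le_add ((abs_add_le _ _).trans (add_le_add
      ((abs_add_le _ _).trans (add_le_add ((abs_add_le _ _).trans (add_le_add
      ((abs_add_le _ _).trans (add_le_add
      (T (by norm_num) ha hp hr hr hr) (T (by norm_num) hb hp hr hr hs)))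
      (T zero_le_one hb hq hr hr hr))) (T (by norm_num) hc hp hr hs hs)))
      (T (by norm_num) hc hq hr hr hs))) (T zero_le_one hd hp hs hs hs)))
      (T (by norm_num) hd hq hr hs hs))) (T (by norm_num) he hq hs hs hs))).trans ?_
    linarith
  · have h : (g.subst γ).e = 1 * g.a * (r * r * r * r) + 1 * g.b * (r * r * r * s) +
        1 * g.c * (r * r * s * s) + 1 * g.d * (r * s * s * s) + 1 * g.e * (s * s * s * s) := by
      simp only [subst, r, s]; ring
    rw [h]
    refine ((abs_add_le _ _).trans (add_le_add ((abs_add_le _ _).trans (add_le_add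
      ((abs_add_le _ _).trans (add_le_add ((abs_add_le _ _).trans (add_le_add
      (T zero_le_one ha hr hr hr hr) (T zero_le_one hb hr hr hr hs)))
      (T zero_le_one hc hr hr hs hs))) (T zero_le_one hd hr hs hs hs)))
      (T zero_le_one he hs hs hs hs))).trans ?_
    linarith

end Growth

/-! ## §5 The cusp, and the finiteness of the class counts -/

section Finiteness

/-- From `H(f) = max(|I|³, J²/4) < X`: `|I| ≤ 1 + X` and `|J| ≤ 1 + 4X` (crude). [folklore] -/
theorem abs_invariants_le_of_height_lt {f : BinaryQuartic ℤ} {X : ℝ} (h : f.height < X) :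
    |(f.I : ℝ)| ≤ 1 + X ∧ |(f.J : ℝ)| ≤ 1 + 4 * X := by
  simp only [height, heightIJ, max_lt_iff] at h
  obtain ⟨hI, hJ⟩ := h
  constructor
  · have key : ∀ y : ℝ, 0 ≤ y → y ≤ 1 + y ^ 3 := by
      intro y hy
      rcases le_or_gt y 1 with h1 | h1
      · linarith [pow_nonneg hy 3]
      · nlinarith [h1, sq_nonneg y]
    linarith [key _ (abs_nonneg (f.I : ℝ))]
  · have key : ∀ y : ℝ, y ≤ 1 + y ^ 2 := fun y ↦ by nlinarith [sq_nonneg (y - 1)]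
    have hJ' : |(f.J : ℝ)| ^ 2 = (f.J : ℝ) ^ 2 := sq_abs _
    linarith [key |(f.J : ℝ)|]

/-- `GL₂(ℤ)`-equivalent forms have the same orbit. [folklore] -/
theorem gl2zOrbit_eq_of_equiv {f g : BinaryQuartic ℤ} (h : GL2ZEquiv f g) :
    gl2zOrbit f = gl2zOrbit g := by
  ext x
  exact ⟨fun hx ↦ h.symm.trans hx, fun hx ↦ h.trans hx⟩

/-- An integer of real absolute value `≤ C` lies in `[-⌈C⌉, ⌈C⌉]`. [folklore] -/
theorem int_mem_Icc_of_abs_le {n : ℤ} {C : ℝ} (h : |(n : ℝ)| ≤ C) : n ∈ Set.Icc (-⌈C⌉) ⌈C⌉ := by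
  obtain ⟨h1, h2⟩ := abs_le.mp h
  have hC := Int.le_ceil C
  constructor
  · have : (-(⌈C⌉ : ℝ)) ≤ (n : ℝ) := by linarith
    exact_mod_cast this
  · have : (n : ℝ) ≤ (⌈C⌉ : ℝ) := h2.trans hC
    exact_mod_cast this

/-- A rotation matrix `(α β; −β α)`, `α² + β² = 1`, has entries of absolute value `≤ 1`. [folklore] -/
theorem abs_rotation_entry_le {α β : ℝ} (h : α ^ 2 + β ^ 2 = 1) :
    ∀ i j, |(!![α, β; -β, α] : Matrix (Fin 2) (Fin 2) ℝ) i j| ≤ 1 := by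
  have hα : |α| ≤ 1 := by
    rw [← sq_le_one_iff_abs_le_one]; nlinarith [sq_nonneg β]
  have hβ : |β| ≤ 1 := by
    rw [← sq_le_one_iff_abs_le_one]; nlinarith [sq_nonneg α]
  intro i j
  fin_cases i <;> fin_cases j <;> simp [abs_neg, hα, hβ]

/-- **Reduction of an irreducible integral form of bounded height** (Bhargava–Shankar 2015,
§2.1–2.3, the structure of `𝓕 h L_V^{(i)}` and "the cusp contains only reducible points"): an
irreducible integral binary quartic form `f` with `H(f) < X`, of nonzero discriminant or definite,
is `GL₂(ℤ)`-equivalent to a form all of whose coefficients are bounded by an explicit constant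
`C(X)`. Proof: over `ℝ`, `f = γ · g` with `g` bounded by `B = 3 + 5X ≥ 1 + |I| + |J|` and
`det γ = ±1` (`exists_eq_subst_bounded`); after a sign change `γ ∈ SL₂(ℝ)`, Gauss reduction
(`exists_sl2z_mul_mem_gaussDomain`) replaces `f` by a `GL₂(ℤ)`-equivalent `f₂ = n(u)a(t)k · g`
with `|u| ≤ ½`, `t⁴ ≥ ¾`; its leading coefficient is `t⁻⁴ · (k·g)_a`, a nonzero integer because
`f` is irreducible (no rational zero, `IsIrreducible.eval_ne_zero`), whence `t⁴ ≤ 30B` — the form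
is not in the cusp — and all coefficients of `f₂` are bounded (`coeff_bound_subst`, thrice).
[cite: BhargavaShankarAnnals2015, §2.1–2.3 (F h L_V^{(i)}; the cusp has a = 0; arXiv:1006.1002v2 numbering)] -/
theorem exists_equiv_coeff_le {f : BinaryQuartic ℤ} (hirr : f.IsIrreducible)
    (htype : f.disc ≠ 0 ∨ (f.map (Int.castRingHom ℝ)).IsDefinite) {X : ℝ} (hX : f.height < X) :
    ∃ f₂ : BinaryQuartic ℤ, GL2ZEquiv f f₂ ∧
      |(f₂.a : ℝ)| ≤ 30 * (30 * (30 * (3 + 5 * X) * (30 * (3 + 5 * X) + 2))) ∧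
      |(f₂.b : ℝ)| ≤ 30 * (30 * (30 * (3 + 5 * X) * (30 * (3 + 5 * X) + 2))) ∧
      |(f₂.c : ℝ)| ≤ 30 * (30 * (30 * (3 + 5 * X) * (30 * (3 + 5 * X) + 2))) ∧
      |(f₂.d : ℝ)| ≤ 30 * (30 * (30 * (3 + 5 * X) * (30 * (3 + 5 * X) + 2))) ∧
      |(f₂.e : ℝ)| ≤ 30 * (30 * (30 * (3 + 5 * X) * (30 * (3 + 5 * X) + 2))) := by
  set B : ℝ := 3 + 5 * X with hBdef
  set fR : BinaryQuartic ℝ := f.map (Int.castRingHom ℝ) with hfR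
  -- Step 1: a bounded representative over `ℝ`
  have htypeR : fR.disc ≠ 0 ∨ fR.IsDefinite := by
    rcases htype with h | h
    · left; rw [hfR, disc_map, eq_intCast]; exact_mod_cast h
    · right; exact h
  obtain ⟨γ, hγ, g, hfg, hga, hgb, hgc, hgd, hge⟩ := exists_eq_subst_bounded fR htypeR
  obtain ⟨hIle, hJle⟩ := abs_invariants_le_of_height_lt hX
  have hB0 : 1 + |fR.I| + |fR.J| ≤ B := by
    rw [hfR, I_map, J_map, eq_intCast, eq_intCast, hBdef]; linarith
  have hga' : |g.a| ≤ B := hga.trans hB0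
  have hgb' : |g.b| ≤ B := hgb.trans hB0
  have hgc' : |g.c| ≤ B := hgc.trans hB0
  have hgd' : |g.d| ≤ B := hgd.trans hB0
  have hge' : |g.e| ≤ B := hge.trans hB0
  have hBpos : 0 ≤ B := (abs_nonneg _).trans hga'
  -- Step 2: make the determinant `+1` by an integral sign change `ε`
  obtain ⟨ε, hεunit, γ₁, hγ₁, hfε⟩ : ∃ ε : Matrix (Fin 2) (Fin 2) ℤ, IsUnit ε.det ∧
      ∃ γ₁ : Matrix (Fin 2) (Fin 2) ℝ, γ₁.det = 1 ∧
        (f.subst ε).map (Int.castRingHom ℝ) = g.subst γ₁ := by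
    rcases hγ with h | h
    · exact ⟨1, by simp, γ, h, by rw [subst_one, ← hfR, hfg]⟩
    · refine ⟨!![1, 0; 0, -1], by rw [Matrix.det_fin_two_of]; norm_num,
        (!![1, 0; 0, -1] : Matrix (Fin 2) (Fin 2) ℤ).map (Int.castRingHom ℝ) * γ, ?_, ?_⟩
      · rw [Matrix.det_mul, h, det_map_ringHom, Matrix.det_fin_two_of]; norm_num
      · rw [map_subst, ← hfR, hfg, ← subst_mul]
  -- Step 3: Gauss reduction of `γ₁`
  obtain ⟨δ, hδ, hgauss⟩ := exists_sl2z_mul_mem_gaussDomain γ₁ hγ₁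
  set m : Matrix (Fin 2) (Fin 2) ℝ := δ.map (Int.castRingHom ℝ) * γ₁ with hmdef
  obtain ⟨hG1, hG2⟩ := hgauss m rfl
  have hmdet : m.det = 1 := by
    rw [hmdef, Matrix.det_mul, hγ₁, mul_one, det_map_ringHom, hδ, map_one]
  set Mz : Matrix (Fin 2) (Fin 2) ℤ := δ * ε with hMz
  have hMzunit : IsUnit Mz.det := by
    rw [hMz, Matrix.det_mul, hδ, one_mul]; exact hεunit
  set f₂ : BinaryQuartic ℤ := f.subst Mz with hf₂
  have hequiv : GL2ZEquiv f f₂ := ⟨Mz, hMzunit, rfl⟩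
  have hf₂R : f₂.map (Int.castRingHom ℝ) = g.subst m := by
    rw [hf₂, hMz, subst_mul, map_subst, hfε, ← subst_mul]
  -- Step 4: Iwasawa coordinates of `m` and the Gauss bounds
  obtain ⟨t, u, α, β, ht, htN, huN, hαβ, -, -, hmnak⟩ := iwasawa_eq hmdet
  obtain ⟨hu, ht4, -⟩ := gaussDomain_bounds (rowNormSq_pos hmdet) ht htN huN
    (by linarith [hG1]) hG2
  -- the three factors
  set k : Matrix (Fin 2) (Fin 2) ℝ := !![α, β; -β, α] with hk
  set at' : Matrix (Fin 2) (Fin 2) ℝ := !![t⁻¹, 0; 0, t] with hat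
  set nu : Matrix (Fin 2) (Fin 2) ℝ := !![1, 0; u, 1] with hnu
  set g₁ := g.subst k with hg₁
  set g₂ := g₁.subst at' with hg₂
  set g₃ := g₂.subst nu with hg₃
  have hf₂g₃ : f₂.map (Int.castRingHom ℝ) = g₃ := by
    rw [hf₂R, hmnak, hg₃, hg₂, hg₁, subst_mul, subst_mul]
  -- bounds for `g₁ = k · g`
  obtain ⟨h1a, h1b, h1c, h1d, h1e⟩ := coeff_bound_subst hga' hgb' hgc' hgd' hge'
    (abs_rotation_entry_le hαβ)
  simp only [one_pow, mul_one] at h1a h1b h1c h1d h1e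
  -- Step 5: the cusp — the leading coefficient of `f₂` is a nonzero integer `= t⁻⁴ (k·g)_a`
  have hlead : (f₂.a : ℝ) = g₁.a * t⁻¹ ^ 4 := by
    have := congrArg BinaryQuartic.a hf₂g₃
    rw [map_a, eq_intCast] at this
    rw [this, hg₃, hnu, subst_lowerShear, hg₂, hat, subst_diagonal]
  have hf₂a : f₂.a ≠ 0 := by
    intro h0
    have hrow : (Mz 0 0 : ℚ) ≠ 0 ∨ (Mz 0 1 : ℚ) ≠ 0 := by
      by_contra hboth
      simp only [not_or, not_not, Int.cast_eq_zero] at hboth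
      have : Mz.det = 0 := by rw [Matrix.det_fin_two, hboth.1, hboth.2]; ring
      exact hMzunit.ne_zero this
    have hne := hirr.eval_ne_zero hrow
    rw [show (Mz 0 0 : ℚ) = Int.castRingHom ℚ (Mz 0 0) from rfl,
      show (Mz 0 1 : ℚ) = Int.castRingHom ℚ (Mz 0 1) from rfl, eval_map, ← subst_a, ← hf₂,
      h0, map_zero] at hne
    exact hne rfl
  have hone : 1 ≤ |(f₂.a : ℝ)| := by
    rw [← Int.cast_abs]; exact_mod_cast Int.one_le_abs hf₂a
  have ht4le : t ^ 4 ≤ 30 * B := by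
    rw [hlead, abs_mul, abs_of_pos (show (0 : ℝ) < t⁻¹ ^ 4 by positivity)] at hone
    have ht4pos : 0 < t ^ 4 := by positivity
    have : 1 * t ^ 4 ≤ |g₁.a| * t⁻¹ ^ 4 * t ^ 4 := mul_le_mul_of_nonneg_right hone ht4pos.le
    rw [one_mul, mul_assoc, ← mul_pow, inv_mul_cancel₀ ht.ne', one_pow, mul_one] at this
    exact this.trans h1a
  -- bounds for the entries of `a(t)`: `Mt = max t t⁻¹`, `Mt⁴ ≤ 30B + 2`
  set Mt : ℝ := max t t⁻¹ with hMt
  have hMt4 : Mt ^ 4 ≤ 30 * B + 2 := by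
    rcases le_total t t⁻¹ with h | h
    · rw [hMt, max_eq_right h, inv_pow]
      have : (t ^ 4)⁻¹ ≤ (3 / 4)⁻¹ := by
        rw [inv_le_inv₀ (by positivity) (by norm_num)]; exact ht4
      linarith [this, show ((3 : ℝ) / 4)⁻¹ = 4 / 3 by norm_num]
    · rw [hMt, max_eq_left h]; linarith
  have hat_entries : ∀ i j, |at' i j| ≤ Mt := by
    intro i j
    fin_cases i <;> fin_cases j
    · simp only [hat, Matrix.of_apply, Matrix.cons_val', Matrix.cons_val_zero,
        Matrix.cons_val_fin_one, Fin.zero_eta, Fin.isValue]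
      rw [abs_of_pos (inv_pos.mpr ht)]; exact le_max_right _ _
    · simp [hat, hMt, ht.le]
    · simp [hat, hMt, ht.le]
    · simp only [hat, Matrix.of_apply, Matrix.cons_val', Matrix.cons_val_one,
        Matrix.cons_val_fin_one, Fin.mk_one, Fin.isValue]
      rw [abs_of_pos ht]; exact le_max_left _ _
  obtain ⟨h2a, h2b, h2c, h2d, h2e⟩ := coeff_bound_subst h1a h1b h1c h1d h1e hat_entries
  -- bounds for the entries of `n(u)`
  have hnu_entries : ∀ i j, |nu i j| ≤ 1 := by
    intro i j
    fin_cases i <;> fin_cases j <;> simp [hnu]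
    exact (abs_le.mpr ⟨by linarith [abs_le.mp hu], by linarith [abs_le.mp hu]⟩ : |u| ≤ 1)
  obtain ⟨h3a, h3b, h3c, h3d, h3e⟩ := coeff_bound_subst h2a h2b h2c h2d h2e hnu_entries
  simp only [one_pow, mul_one] at h3a h3b h3c h3d h3e
  -- the common bound
  have hK : 30 * (30 * (30 * B * Mt ^ 4)) ≤ 30 * (30 * (30 * B * (30 * B + 2))) := by
    have : 30 * B * Mt ^ 4 ≤ 30 * B * (30 * B + 2) :=
      mul_le_mul_of_nonneg_left hMt4 (by positivity)
    exact mul_le_mul_of_nonneg_left (mul_le_mul_of_nonneg_left this (by norm_num)) (by norm_num)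
  have hcoef : ∀ {x : ℤ} {y : ℝ}, (x : ℝ) = y → |y| ≤ 30 * (30 * (30 * B * Mt ^ 4)) →
      |(x : ℝ)| ≤ 30 * (30 * (30 * B * (30 * B + 2))) := by
    intro x y hxy hy; rw [hxy]; exact hy.trans hK
  have ea := congrArg BinaryQuartic.a hf₂g₃
  have eb := congrArg BinaryQuartic.b hf₂g₃
  have ec := congrArg BinaryQuartic.c hf₂g₃
  have ed := congrArg BinaryQuartic.d hf₂g₃
  have ee := congrArg BinaryQuartic.e hf₂g₃
  rw [map_a, eq_intCast] at ea
  rw [map_b, eq_intCast] at eb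
  rw [map_c, eq_intCast] at ec
  rw [map_d, eq_intCast] at ed
  rw [map_e, eq_intCast] at ee
  exact ⟨f₂, hequiv, hcoef ea h3a, hcoef eb h3b, hcoef ec h3c, hcoef ed h3d, hcoef ee h3e⟩

/-- **Finiteness of the class counts (Hermite; Borel–Harish-Chandra), unconditionally**: for every
`X`, the set of `GL₂(ℤ)`-orbits of irreducible integral binary quartic forms `f` with `H(f) < X`
and (`Δ(f) ≠ 0` or `f` definite) is finite — they are the orbits of the finitely many integral forms
with coefficients bounded by `C(X)` (`exists_equiv_coeff_le`). In `BinaryQuarticForms.lean` the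
counts `N(S; X) = gl2zClassCount S X` are the `Set.ncard` of these orbit sets ("finite by
Borel–Harish-Chandra; junk value `0` if infinite"); Bhargava–Shankar, Thm 2.1, counts them.
[cite: BhargavaShankarAnnals2015, Thm 2.1 and §2.1–2.3 (arXiv:1006.1002v2 numbering)] -/
theorem finite_gl2zOrbits (X : ℝ) :
    (gl2zOrbit '' {f : BinaryQuartic ℤ | (f.disc ≠ 0 ∨ (f.map (Int.castRingHom ℝ)).IsDefinite) ∧
      f.IsIrreducible ∧ f.height < X}).Finite := by
  set C : ℝ := 30 * (30 * (30 * (3 + 5 * X) * (30 * (3 + 5 * X) + 2))) with hC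
  set K : ℤ := ⌈C⌉ with hK
  set box : Set (ℤ × ℤ × ℤ × ℤ × ℤ) := Set.Icc (-K) K ×ˢ (Set.Icc (-K) K ×ˢ (Set.Icc (-K) K ×ˢ
    (Set.Icc (-K) K ×ˢ Set.Icc (-K) K))) with hbox
  have hfin : box.Finite :=
    (Set.finite_Icc _ _).prod ((Set.finite_Icc _ _).prod ((Set.finite_Icc _ _).prod
      ((Set.finite_Icc _ _).prod (Set.finite_Icc _ _))))
  refine (hfin.image fun v ↦ gl2zOrbit ⟨v.1, v.2.1, v.2.2.1, v.2.2.2.1, v.2.2.2.2⟩).subset ?_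
  rintro _ ⟨f, ⟨htype, hirr, hX⟩, rfl⟩
  obtain ⟨f₂, hequiv, ha, hb, hc, hd, he⟩ := exists_equiv_coeff_le hirr htype hX
  refine ⟨(f₂.a, f₂.b, f₂.c, f₂.d, f₂.e), ?_, ?_⟩
  · simp only [hbox, Set.mem_prod]
    exact ⟨int_mem_Icc_of_abs_le ha, int_mem_Icc_of_abs_le hb, int_mem_Icc_of_abs_le hc,
      int_mem_Icc_of_abs_le hd, int_mem_Icc_of_abs_le he⟩
  · exact (gl2zOrbit_eq_of_equiv hequiv).symm

/-- The finiteness for any `S ⊆ {Δ ≠ 0} ∪ {definite}` (all of Bhargava–Shankar's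
`V_ℤ^{(0)}, V_ℤ^{(1)}, V_ℤ^{(2)}, V_ℤ^{(2±)}`): the orbit set defining `N(S; X)` is finite.
[cite: BhargavaShankarAnnals2015, Thm 2.1 (N(S;X) is a finite count)] -/
theorem finite_gl2zOrbits_of_subset {S : Set (BinaryQuartic ℤ)}
    (hS : S ⊆ {f | f.disc ≠ 0 ∨ (f.map (Int.castRingHom ℝ)).IsDefinite}) (X : ℝ) :
    (gl2zOrbit '' {f : BinaryQuartic ℤ | f ∈ S ∧ f.IsIrreducible ∧ f.height < X}).Finite :=
  (finite_gl2zOrbits X).subset (Set.image_mono fun _ hf ↦ ⟨hS hf.1, hf.2⟩)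

/-- **The orbit sets of `V_ℤ^{(0)}`, `V_ℤ^{(1)}`, `V_ℤ^{(2)}` and `V_ℤ^{(2+)}` are finite,
unconditionally** — the conclusion of `finite_orbits_of_classCount`
(`BhargavaShankarClassCountProofs`) without its hypothesis `bhargavaShankar_classCount` (Thm 2.1).
[cite: BhargavaShankarAnnals2015, Thm 2.1 and §2.1 (arXiv:1006.1002v2 numbering)] -/
theorem finite_orbits_realTypes (Y : ℝ) :
    (gl2zOrbit '' {f | f ∈ fourRealRoots ∧ f.IsIrreducible ∧ f.height < Y}).Finite ∧
    (gl2zOrbit '' {f | f ∈ twoRealRoots ∧ f.IsIrreducible ∧ f.height < Y}).Finite ∧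
    (gl2zOrbit '' {f | f ∈ noRealRoots ∧ f.IsIrreducible ∧ f.height < Y}).Finite ∧
    (gl2zOrbit '' {f | f ∈ posDefinite ∧ f.IsIrreducible ∧ f.height < Y}).Finite := by
  refine ⟨finite_gl2zOrbits_of_subset (fun f hf ↦ Or.inl (ne_of_gt hf.1)) Y,
    finite_gl2zOrbits_of_subset (fun f hf ↦ Or.inl (ne_of_lt hf)) Y,
    finite_gl2zOrbits_of_subset (fun f hf ↦ Or.inr hf) Y,
    finite_gl2zOrbits_of_subset (fun f hf ↦ Or.inr (posDefinite_subset_noRealRoots hf)) Y⟩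

/-- In particular the class counts `N(V_ℤ^{(i)}; X)` of Thm 2.1 are honest cardinalities: e.g.
`N(V_ℤ^{(1)}; X)` is the number of elements of a finite set of orbits, positive as soon as one
irreducible `f ∈ V_ℤ^{(1)}` has `H(f) < X`. [cite: BhargavaShankarAnnals2015, Thm 2.1 (arXiv:1006.1002v2 numbering)] -/
theorem gl2zClassCount_pos_of_mem {S : Set (BinaryQuartic ℤ)}
    (hS : S ⊆ {f | f.disc ≠ 0 ∨ (f.map (Int.castRingHom ℝ)).IsDefinite}) {X : ℝ}
    {f : BinaryQuartic ℤ} (hf : f ∈ S) (hirr : f.IsIrreducible) (hX : f.height < X) :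
    0 < gl2zClassCount S X := by
  rw [gl2zClassCount, Set.ncard_pos (finite_gl2zOrbits_of_subset hS X)]
  exact ⟨gl2zOrbit f, f, ⟨hf, hirr, hX⟩, rfl⟩

end Finiteness

end BinaryQuartic

end Literature.NumberTheory.EllipticCurves

end
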